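import Literature.NumberTheory.Sieve.SmoothMajorantLocal
import Mathlib.Algebra.BigOperators.Expect
import Mathlib.Algebra.BigOperators.Fin
import Mathlib.Algebra.Field.ZMod
import Mathlib.Data.ZMod.QuotientRing
import Mathlib.Data.Nat.Squarefree
import Mathlib.Analysis.SpecialFunctions.Pow.Real
import HarnessLib

/-!
# Local input for the smooth linear forms estimate (Conlon–Fox–Zhao §9): the Chinese remainder step

Trunk T-SIEVE. Second brick for the proof of `Literature.NumberTheory.Sieve.GreenTao2008.SmoothLinearFormsEstimate` (CFZ
Prop. 8.3; discharged in `SmoothMajorantFinal`), §9 of D. Conlon, J. Fox, Y. Zhao, *The Green–Tao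
theorem: an exposition* (arXiv:1403.2957), p. 17 ("Splitting `d_1, d'_1, …, d_m, d'_m` in (32) into
prime factors, we obtain" the Euler product (33)). The Chinese remainder step made explicit here is
spelled out in B. Green, T. Tao, Ann. of Math. 167 (2008), §10, p. 531: "We begin by using the
Chinese remainder theorem (and the square-free nature of `d_i, d'_i`) to rewrite
`E[∏_i 1_{d_i,d'_i ∣ θ_i(x)} | x ∈ ℤ_D^t] = ∏_{p ∣ D} E[∏_{i : p ∣ d_i d'_i} 1_{θ_i(x) ≡ 0 (mod p)} | x ∈ ℤ_p^t]`"
(displays (10.2)–(10.3) there).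

* `crtSquarefree hD : ZMod D ≃+* (Π_{p ∣ D} ZMod p)` for squarefree `D` (Mathlib's
  `ZMod.prodEquivPi` over the prime factors);
* `expect_prod_crt`: for weights `h_p` on `ℤ_p^t`, `p ∣ D`,
  `E_{y ∈ ℤ_D^t} ∏_{p ∣ D} h_p(y mod p) = ∏_{p ∣ D} E_{z ∈ ℤ_p^t} h_p(z)` (independence of the
  coordinates of the Chinese remainder isomorphism).

## References
* D. Conlon, J. Fox, Y. Zhao, EMS Surv. Math. Sci. 1 (2014), 249–282, §9 (p. 17).
  [cite: ConlonFoxZhao2014]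
* B. Green, T. Tao, Ann. of Math. 167 (2008), (10.2)–(10.3). [cite: GreenTaoAnnals2008]
-/

noncomputable section

open Finset
open scoped BigOperators

namespace Literature.NumberTheory.Sieve.CFZ

/-- The prime factors of `D`, as a type, are nonzero naturals (so that `ZMod p` is finite).
[folklore] -/
instance neZero_coe_primeFactors {D : ℕ} (p : D.primeFactors) : NeZero ((p : ℕ)) :=
  ⟨(Nat.prime_of_mem_primeFactors p.2).ne_zero⟩

/-- The prime factors of `D` are primes (as a `Fact`, so that `ZMod p` is a field). [folklore] -/
theorem fact_prime_coe_primeFactors {D : ℕ} (p : D.primeFactors) : Fact (p : ℕ).Prime :=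
  ⟨Nat.prime_of_mem_primeFactors p.2⟩

/-- `D = ∏_{p ∣ D} p` for squarefree `D` (product over the type of prime factors).
[folklore] -/
theorem eq_prod_coe_primeFactors {D : ℕ} (hD : Squarefree D) : D = ∏ p : D.primeFactors, (p : ℕ) := by
  rw [prod_coe_sort D.primeFactors (fun p => p), Nat.prod_primeFactors_of_squarefree hD]

/-- **The Chinese remainder isomorphism for squarefree `D`**: `ℤ_D ≅ ∏_{p ∣ D} ℤ_p`.
[cite: GreenTaoAnnals2008, Section 10, (10.2)–(10.3)] [cite: ConlonFoxZhao2014, Section 9, (32)–(33)] -/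
def crtSquarefree {D : ℕ} (hD : Squarefree D) : ZMod D ≃+* ((p : D.primeFactors) → ZMod (p : ℕ)) :=
  (ZMod.ringEquivCongr (eq_prod_coe_primeFactors hD)).trans
    (ZMod.prodEquivPi (fun p : D.primeFactors => (p : ℕ)) fun p q hpq =>
      (Nat.coprime_primes (Nat.prime_of_mem_primeFactors p.2) (Nat.prime_of_mem_primeFactors q.2)).2
        fun h => hpq (Subtype.ext h))

/-- Independence of coordinates: `E_{w ∈ ∏_i K_i} ∏_i f_i(w_i) = ∏_i E_{z ∈ K_i} f_i(z)`.
[folklore] -/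
theorem expect_pi_prod {ι : Type*} [Fintype ι] [DecidableEq ι] {K : ι → Type*} [∀ i, Fintype (K i)]
    [∀ i, Nonempty (K i)] (f : ∀ i, K i → ℝ) :
    𝔼 w : (∀ i, K i), ∏ i, f i (w i) = ∏ i, 𝔼 z : K i, f i z := by
  rw [Fintype.expect_eq_sum_div_card, ← Fintype.prod_sum, Fintype.card_pi, Nat.cast_prod,
    ← prod_div_distrib]
  exact prod_congr rfl fun i _ => (Fintype.expect_eq_sum_div_card _).symm

/-- **Chinese remainder factorisation of averages over `ℤ_D^t`** (Green–Tao 2008, §10,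
(10.2)–(10.3); used implicitly in CFZ §9, p. 17, (32)→(33)): for squarefree `D` and weights
`h_p : ℤ_p^t → ℝ`, `p ∣ D`, `E_{y ∈ ℤ_D^t} ∏_{p ∣ D} h_p(y mod p) = ∏_{p ∣ D} E_{z ∈ ℤ_p^t} h_p(z)`.
[cite: GreenTaoAnnals2008, Section 10, (10.2)–(10.3)] [cite: ConlonFoxZhao2014, Section 9, (32)–(33)] -/
theorem expect_prod_crt {D t : ℕ} (hD : Squarefree D)
    (h : ∀ p : D.primeFactors, (Fin t → ZMod (p : ℕ)) → ℝ) :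
    haveI : NeZero D := ⟨hD.ne_zero⟩
    𝔼 y : Fin t → ZMod D, ∏ p, h p (fun j => crtSquarefree hD (y j) p) =
      ∏ p : D.primeFactors, 𝔼 z : Fin t → ZMod (p : ℕ), h p z := by
  classical
  haveI : NeZero D := ⟨hD.ne_zero⟩
  -- `ℤ_D^t ≃ ∏_p ℤ_p^t`
  set e : (Fin t → ZMod D) ≃ (∀ p : D.primeFactors, Fin t → ZMod (p : ℕ)) :=
    (Equiv.arrowCongr (Equiv.refl (Fin t)) (crtSquarefree hD).toEquiv).trans
      (Equiv.piComm fun (_ : Fin t) (p : D.primeFactors) => ZMod (p : ℕ)) with he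
  rw [Fintype.expect_equiv e _ (fun w => ∏ p, h p (w p)) (fun y => by rfl), expect_pi_prod]


/-! ### Tuples of squarefree `P`-numbers and the finite Euler product -/

/-- The squarefree numbers all of whose prime factors lie in the finite set of primes `P`:
the products of subsets of `P`. [cite: ConlonFoxZhao2014, Section 9, equation (33)] -/
def squarefreeOf (P : Finset ℕ) : Finset ℕ := P.powerset.image fun T => ∏ p ∈ T, p

/-- A product of distinct primes is squarefree. [folklore] -/
theorem squarefree_prod_of_primes {T : Finset ℕ} (hT : ∀ p ∈ T, p.Prime) : Squarefree (∏ p ∈ T, p) := by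
  refine Finset.squarefree_prod_of_pairwise_isCoprime ?_ fun p hp => (hT p hp).squarefree
  intro p hp q hq hpq
  exact Nat.coprime_iff_isRelPrime.1 ((Nat.coprime_primes (hT p hp) (hT q hq)).2 hpq)

/-- Membership in `squarefreeOf P` for a set of primes `P`: squarefree with prime factors in `P`.
[cite: ConlonFoxZhao2014, Section 9, equation (33)] -/
theorem mem_squarefreeOf {P : Finset ℕ} (hP : ∀ p ∈ P, p.Prime) {d : ℕ} :
    d ∈ squarefreeOf P ↔ Squarefree d ∧ d.primeFactors ⊆ P := by
  constructor
  · intro hd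
    obtain ⟨T, hT, rfl⟩ := mem_image.1 hd
    have hTP := mem_powerset.1 hT
    have hTp : ∀ p ∈ T, p.Prime := fun p hp => hP p (hTP hp)
    exact ⟨squarefree_prod_of_primes hTp, by rw [Nat.primeFactors_prod hTp]; exact hTP⟩
  · rintro ⟨hsf, hsub⟩
    exact mem_image.2 ⟨d.primeFactors, mem_powerset.2 hsub, Nat.prod_primeFactors_of_squarefree hsf⟩

/-- The divisibility pattern `X_p(d) = {i : p ∣ d_i}` of a tuple at the prime `p`.
[cite: ConlonFoxZhao2014, Section 9, equation (33)] -/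
def pattern {ι : Type*} [Fintype ι] (d : ι → ℕ) (p : ℕ) : Finset ι := univ.filter fun i => p ∣ d i

/-- The tuple with prescribed patterns: `d_i = ∏_{p ∈ P : i ∈ g(p)} p`.
[cite: ConlonFoxZhao2014, Section 9, equation (33)] -/
def tupleOfPattern {ι : Type*} [DecidableEq ι] (P : Finset ℕ) (g : P → Finset ι) (i : ι) : ℕ :=
  ∏ p ∈ P.attach.filter (fun p => i ∈ g p), (p : ℕ)

/-- `p ∣ ∏_{q ∈ S} q ↔ p ∈ S` for a set `S` of primes and a prime `p`. [folklore] -/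
theorem prime_dvd_prod_primes_iff {P : Finset ℕ} (hP : ∀ p ∈ P, p.Prime) (S : Finset P) {p : P} :
    (p : ℕ) ∣ ∏ q ∈ S, (q : ℕ) ↔ p ∈ S := by
  have hp : (p : ℕ).Prime := hP p p.2
  rw [(Nat.prime_iff.1 hp).dvd_finsetProd_iff]
  constructor
  · rintro ⟨q, hq, hdvd⟩
    have : (p : ℕ) = q := (Nat.prime_dvd_prime_iff_eq hp (hP q q.2)).1 hdvd
    rwa [Subtype.ext this]
  · intro h; exact ⟨p, h, dvd_rfl⟩

/-- The constructed tuple has the prescribed patterns. [cite: ConlonFoxZhao2014, Section 9, equation (33)] -/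
theorem pattern_tupleOfPattern {ι : Type*} [Fintype ι] [DecidableEq ι] {P : Finset ℕ}
    (hP : ∀ p ∈ P, p.Prime) (g : P → Finset ι) (p : P) : pattern (tupleOfPattern P g) p = g p := by
  ext i
  simp only [pattern, mem_filter, mem_univ, true_and]
  unfold tupleOfPattern
  rw [prime_dvd_prod_primes_iff hP]
  simp

/-- **The finite Euler product** (CFZ p. 17: "Splitting `d_1, d'_1, …, d_m, d'_m` into prime factors,
we obtain `∑_{d} … = ∏_p E_p`"): for a finite set of primes `P`, commutative weights `f_p(X)`
indexed by the divisibility patterns `X ⊆ [r]`, summing `∏_{p ∈ P} f_p(X_p(d))` over all `r`-tuples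
`d` of squarefree numbers with prime factors in `P` gives `∏_{p ∈ P} ∑_{X ⊆ [r]} f_p(X)`.
[cite: ConlonFoxZhao2014, Section 9 (from eq. 9.5 to eq. 9.6)] -/
theorem sum_squarefreeTuples_eq_prod {R : Type*} [CommSemiring R] {ι : Type*} [Fintype ι]
    [DecidableEq ι] {P : Finset ℕ} (hP : ∀ p ∈ P, p.Prime) (f : P → Finset ι → R) :
    ∑ d ∈ Fintype.piFinset (fun _ : ι => squarefreeOf P), ∏ p : P, f p (pattern d p) =
      ∏ p : P, ∑ X : Finset ι, f p X := by
  rw [Fintype.prod_sum]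
  -- bijection `g ↦ tupleOfPattern P g` from pattern maps to tuples
  symm
  refine sum_nbij' (fun g => tupleOfPattern P g) (fun d => fun p => pattern d p) ?_ ?_ ?_ ?_ ?_
  · -- maps into tuples of squarefree `P`-numbers
    intro g _
    refine Fintype.mem_piFinset.2 fun i => (mem_squarefreeOf hP).2 ⟨?_, ?_⟩
    · unfold tupleOfPattern
      rw [← prod_image (s := P.attach.filter (fun p => i ∈ g p)) (g := fun p : P => (p : ℕ))
        (f := fun q : ℕ => q) (fun p _ q _ h => Subtype.ext h)]
      exact squarefree_prod_of_primes fun q hq => by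
        obtain ⟨p, -, rfl⟩ := mem_image.1 hq; exact hP p p.2
    · intro q hq
      have hq' := Nat.dvd_of_mem_primeFactors hq
      have hqp := Nat.prime_of_mem_primeFactors hq
      unfold tupleOfPattern at hq'
      obtain ⟨p, -, hdvd⟩ := ((Nat.prime_iff.1 hqp).dvd_finsetProd_iff _).1 hq'
      have : q = p := (Nat.prime_dvd_prime_iff_eq hqp (hP p p.2)).1 hdvd
      rw [this]; exact p.2
  · -- maps back
    intro d _; exact mem_univ _
  · -- left inverse: patterns of the constructed tuple
    intro g _
    funext p
    exact pattern_tupleOfPattern hP g p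
  · -- right inverse: the tuple is recovered from its patterns
    intro d hd
    funext i
    have hdi := (mem_squarefreeOf hP).1 (Fintype.mem_piFinset.1 hd i)
    unfold tupleOfPattern
    rw [← prod_image (s := P.attach.filter (fun p : P => i ∈ pattern d (p : ℕ))) (g := fun p : P => (p : ℕ))
      (f := fun q : ℕ => q) (fun p _ q _ h => Subtype.ext h)]
    rw [show (P.attach.filter (fun p : P => i ∈ pattern d (p : ℕ))).image (fun p : P => (p : ℕ)) =
        (d i).primeFactors from ?_,
      Nat.prod_primeFactors_of_squarefree hdi.1]
    ext q
    simp only [mem_image, mem_filter, mem_attach, true_and, pattern, mem_univ]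
    constructor
    · rintro ⟨p, hp, rfl⟩
      exact Nat.mem_primeFactors.2 ⟨hP p p.2, hp, hdi.1.ne_zero⟩
    · intro hq
      exact ⟨⟨q, hdi.2 hq⟩, Nat.dvd_of_mem_primeFactors hq, rfl⟩
  · -- the summands agree
    intro g _
    exact Fintype.prod_congr _ _ fun p => by rw [pattern_tupleOfPattern hP g p]


/-! ### The `W`-trick at a single prime -/

/-- The form `θ_i(x) = W ψ_i(x) + 1 = W (∑_j L_{ij} x_j + b_i) + 1`, read in any commutative ring
(`ℤ`, `ℤ_D`, `ℤ_p`). [cite: ConlonFoxZhao2014, Proposition 8.3] -/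
def wForm {R : Type*} [CommRing R] {t : ℕ} (W : ℕ) (L : Fin t → ℤ) (b : ℤ) (x : Fin t → R) : R :=
  (W : R) * (∑ j, (L j : R) * x j + (b : R)) + 1

/-- `θ_i` commutes with ring homomorphisms (reduction modulo `D`, the Chinese remainder map).
[cite: ConlonFoxZhao2014, Section 9] -/
theorem map_wForm {R S : Type*} [CommRing R] [CommRing S] (φ : R →+* S) {t : ℕ} (W : ℕ)
    (L : Fin t → ℤ) (b : ℤ) (x : Fin t → R) : φ (wForm W L b x) = wForm W L b (φ ∘ x) := by
  simp [wForm, map_add, map_mul, map_sum, map_natCast, map_intCast, map_one]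

/-- On integer points `θ_i` is the genuine integer `W(∑_j L_{ij} x_j + b_i) + 1`.
[cite: ConlonFoxZhao2014, Proposition 8.3] -/
theorem wForm_int {t : ℕ} (W : ℕ) (L : Fin t → ℤ) (b : ℤ) (x : Fin t → ℤ) :
    wForm W L b x = W * (∑ j, L j * x j + b) + 1 := by
  simp [wForm]

/-- For `p ∣ W`, `θ_i ≡ 1 (mod p)` never vanishes ("`E_p(ξ) = 1` when `p ≤ w`", p. 17).
[cite: ConlonFoxZhao2014, Section 9] -/
theorem wForm_ne_zero_of_dvd {t p W : ℕ} [Fact p.Prime] (hpW : p ∣ W) (L : Fin t → ℤ) (b : ℤ)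
    (x : Fin t → ZMod p) : wForm W L b x ≠ 0 := by
  unfold wForm
  rw [(ZMod.natCast_eq_zero_iff W p).2 hpW, zero_mul, zero_add]
  exact one_ne_zero

/-- For `p ∤ W`, `θ_i(x) = 0` in `ℤ_p` is the affine equation `∑_j (W L_{ij}) x_j = -(W b_i + 1)`.
[cite: ConlonFoxZhao2014, Section 9] -/
theorem wForm_eq_zero_iff {t p W : ℕ} (L : Fin t → ℤ) (b : ℤ) (x : Fin t → ZMod p) :
    wForm W L b x = 0 ↔ ∑ j, ((W : ZMod p) * (L j : ZMod p)) * x j = -((W : ZMod p) * b + 1) := by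
  unfold wForm
  rw [mul_add, mul_sum, ← sub_eq_zero (b := -((W : ZMod p) * b + 1))]
  simp only [mul_assoc, sub_neg_eq_add]
  constructor <;> intro h <;> linear_combination h

/-- The coefficient vector `W L_i` is nonzero modulo `p` when `p ∤ W` and `L_i ≢ 0 (mod p)`.
[cite: ConlonFoxZhao2014, Section 9] -/
theorem wCoeff_ne_zero {t p W : ℕ} [Fact p.Prime] (hpW : ¬ p ∣ W) {L : Fin t → ℤ} {j : Fin t}
    (hL : (L j : ZMod p) ≠ 0) : (W : ZMod p) * (L j : ZMod p) ≠ 0 :=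
  mul_ne_zero (fun h => hpW ((ZMod.natCast_eq_zero_iff W p).1 h)) hL

/-- The `2×2` minors of `W L` are `W²` times those of `L`, hence nonzero modulo `p` when
`p ∤ W` and the minor of `L` is nonzero modulo `p`. [cite: ConlonFoxZhao2014, Section 9] -/
theorem wMinor_ne_zero {t p W : ℕ} [Fact p.Prime] (hpW : ¬ p ∣ W) {L L' : Fin t → ℤ} {j₀ j₁ : Fin t}
    (hM : ((L j₀ * L' j₁ - L j₁ * L' j₀ : ℤ) : ZMod p) ≠ 0) :
    ((W : ZMod p) * L j₀) * ((W : ZMod p) * L' j₁) - ((W : ZMod p) * L j₁) * ((W : ZMod p) * L' j₀) ≠ 0 := by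
  have hW : (W : ZMod p) ≠ 0 := fun h => hpW ((ZMod.natCast_eq_zero_iff W p).1 h)
  have : ((W : ZMod p) * L j₀) * ((W : ZMod p) * L' j₁) - ((W : ZMod p) * L j₁) * ((W : ZMod p) * L' j₀) =
      (W : ZMod p) ^ 2 * (((L j₀ * L' j₁ - L j₁ * L' j₀ : ℤ) : ZMod p)) := by
    push_cast; ring
  rw [this]
  exact mul_ne_zero (pow_ne_zero 2 hW) hM


/-! ### The local densities `ω_p(X)` of p. 17 -/

/-- `ω_p(X) = E_{x ∈ ℤ_p^t}[θ_i(x) ≡ 0 (mod p) for all i ∈ X]` (CFZ p. 17; Green–Tao (10.3)).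
[cite: ConlonFoxZhao2014, Section 9 (the Euler factor E_p)] -/
def localDensity {m t : ℕ} (p W : ℕ) [NeZero p] (L : Fin m → Fin t → ℤ) (b : Fin m → ℤ)
    (X : Finset (Fin m)) : ℝ :=
  #((univ : Finset (Fin t → ZMod p)).filter fun x => ∀ i ∈ X, wForm W (L i) (b i) x = 0) / (p : ℝ) ^ t

/-- `ω_p(∅) = 1`. [cite: ConlonFoxZhao2014, Section 9] -/
theorem localDensity_empty {m t p W : ℕ} [NeZero p] (L : Fin m → Fin t → ℤ) (b : Fin m → ℤ) :
    localDensity p W L b ∅ = 1 := by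
  unfold localDensity
  rw [filter_true_of_mem (fun x _ => by simp), card_univ, Fintype.card_fun, ZMod.card, Fintype.card_fin]
  have : (p : ℝ) ^ t ≠ 0 := pow_ne_zero _ (by exact_mod_cast NeZero.ne p)
  push_cast
  exact div_self this

/-- `0 ≤ ω_p(X) ≤ 1`. [cite: ConlonFoxZhao2014, Section 9] -/
theorem localDensity_nonneg_le_one {m t p W : ℕ} [NeZero p] (L : Fin m → Fin t → ℤ) (b : Fin m → ℤ)
    (X : Finset (Fin m)) : 0 ≤ localDensity p W L b X ∧ localDensity p W L b X ≤ 1 := by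
  unfold localDensity
  have hp : (0 : ℝ) < (p : ℝ) ^ t := pow_pos (by exact_mod_cast Nat.pos_of_ne_zero (NeZero.ne p)) _
  refine ⟨by positivity, (div_le_one hp).2 ?_⟩
  have := card_le_univ ((univ : Finset (Fin t → ZMod p)).filter fun x => ∀ i ∈ X, wForm W (L i) (b i) x = 0)
  rw [Fintype.card_fun, ZMod.card, Fintype.card_fin] at this
  exact_mod_cast this

/-- `ω_p` is antitone in `X`. [cite: ConlonFoxZhao2014, Section 9] -/
theorem localDensity_mono {m t p W : ℕ} [NeZero p] (L : Fin m → Fin t → ℤ) (b : Fin m → ℤ)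
    {X Y : Finset (Fin m)} (h : X ⊆ Y) : localDensity p W L b Y ≤ localDensity p W L b X := by
  unfold localDensity
  refine div_le_div_of_nonneg_right ?_ (by positivity)
  have hsub : ((univ : Finset (Fin t → ZMod p)).filter fun x => ∀ i ∈ Y, wForm W (L i) (b i) x = 0) ⊆
      (univ : Finset (Fin t → ZMod p)).filter fun x => ∀ i ∈ X, wForm W (L i) (b i) x = 0 :=
    fun x hx => mem_filter.2 ⟨mem_univ _, fun i hi => (mem_filter.1 hx).2 i (h hi)⟩
  exact_mod_cast card_le_card hsub

/-- For `p ∣ W` (i.e. `p ≤ w`) and `X ≠ ∅`: `ω_p(X) = 0` ("`E_p = 1` when `p ≤ w`").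
[cite: ConlonFoxZhao2014, Section 9] -/
theorem localDensity_eq_zero_of_dvd {m t p W : ℕ} [Fact p.Prime] (hpW : p ∣ W) (L : Fin m → Fin t → ℤ)
    (b : Fin m → ℤ) {X : Finset (Fin m)} (hX : X.Nonempty) : localDensity p W L b X = 0 := by
  unfold localDensity
  obtain ⟨i, hi⟩ := hX
  rw [filter_false_of_mem, card_empty, Nat.cast_zero, zero_div]
  intro x _ hx
  exact wForm_ne_zero_of_dvd hpW (L i) (b i) x (hx i hi)

/-- For `p ∤ W` and `L_i ≢ 0 (mod p)`: `ω_p({i}) = 1/p` ("`1/p` if `d_j d'_j = 1` for all except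
exactly one `j`"). [cite: ConlonFoxZhao2014, Section 9] -/
theorem localDensity_singleton {m n p W : ℕ} [Fact p.Prime] (hpW : ¬ p ∣ W) (L : Fin m → Fin (n + 1) → ℤ)
    (b : Fin m → ℤ) (i : Fin m) {j₀ : Fin (n + 1)} (hL : (L i j₀ : ZMod p) ≠ 0) :
    localDensity p W L b {i} = 1 / p := by
  unfold localDensity
  have hset : ((univ : Finset (Fin (n + 1) → ZMod p)).filter fun x => ∀ i' ∈ ({i} : Finset (Fin m)),
      wForm W (L i') (b i') x = 0) = (univ : Finset (Fin (n + 1) → ZMod p)).filter fun x =>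
        ∑ j, ((W : ZMod p) * (L i j : ZMod p)) * x j = -((W : ZMod p) * b i + 1) :=
    filter_congr fun x _ => by simp only [mem_singleton, forall_eq]; rw [wForm_eq_zero_iff]
  rw [hset, card_affineHyperplane j₀ _ (wCoeff_ne_zero hpW hL)]
  have hp0 : (p : ℝ) ≠ 0 := by exact_mod_cast (Fact.out : p.Prime).ne_zero
  rw [pow_succ]
  push_cast
  field_simp

/-- For `p ∤ W` and two rows `i ≠ i'` of `X` with a `2×2` minor `≢ 0 (mod p)`: `ω_p(X) ≤ 1/p²`
("at most `1/p²` otherwise"). [cite: ConlonFoxZhao2014, Section 9] -/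
theorem localDensity_le_of_minor {m t p W : ℕ} [Fact p.Prime] (hpW : ¬ p ∣ W) (L : Fin m → Fin t → ℤ)
    (b : Fin m → ℤ) {X : Finset (Fin m)} {i i' : Fin m} (hi : i ∈ X) (hi' : i' ∈ X)
    {j₀ j₁ : Fin t} (hj : j₀ ≠ j₁) (hM : ((L i j₀ * L i' j₁ - L i j₁ * L i' j₀ : ℤ) : ZMod p) ≠ 0) :
    localDensity p W L b X ≤ 1 / (p : ℝ) ^ 2 := by
  have hii' : i ≠ i' := by
    rintro rfl
    apply hM
    push_cast
    ring
  calc localDensity p W L b X ≤ localDensity p W L b {i, i'} :=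
        localDensity_mono L b (insert_subset hi (singleton_subset_iff.2 hi'))
    _ ≤ 1 / (p : ℝ) ^ 2 := by
        unfold localDensity
        have hsub : ((univ : Finset (Fin t → ZMod p)).filter fun x => ∀ k ∈ ({i, i'} : Finset (Fin m)),
            wForm W (L k) (b k) x = 0) ⊆ (univ : Finset (Fin t → ZMod p)).filter fun x =>
              ∑ j, ((W : ZMod p) * (L i j : ZMod p)) * x j = -((W : ZMod p) * b i + 1) ∧
              ∑ j, ((W : ZMod p) * (L i' j : ZMod p)) * x j = -((W : ZMod p) * b i' + 1) := by
          intro x hx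
          have h := (mem_filter.1 hx).2
          refine mem_filter.2 ⟨mem_univ _, ?_, ?_⟩
          · exact (wForm_eq_zero_iff _ _ _).1 (h i (by simp))
          · exact (wForm_eq_zero_iff _ _ _).1 (h i' (by simp))
        have hcard := (card_le_card hsub).trans
          (card_two_affineHyperplanes_le hj _ _ (wMinor_ne_zero hpW hM) _ _)
        have hp : (0 : ℝ) < p := by exact_mod_cast (Fact.out : p.Prime).pos
        rw [div_le_div_iff₀ (pow_pos hp t) (pow_pos hp 2), one_mul]
        have h2 : t - 2 + 2 = t ∨ t < 2 := by omega
        rcases h2 with h2 | h2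
        · calc (#_ : ℝ) * (p : ℝ) ^ 2 ≤ (p : ℝ) ^ (t - 2) * (p : ℝ) ^ 2 := by
                gcongr; exact_mod_cast hcard
            _ = (p : ℝ) ^ t := by rw [← pow_add, h2]
        · -- `t < 2` is impossible: two distinct columns exist
          exfalso
          have := j₀.2; have := j₁.2; omega

end Literature.NumberTheory.Sieve.CFZ
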